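import Mathlib.Analysis.Matrix.Spectrum
import HarnessLib

/-!
# Centre-flux plaquette-cycle inequalities (stub `stub_fluxTemplateHalf`, part 1 of 3)

Helper file for stub `stub_fluxTemplateHalf` (S5b-m) of line `free-volume-heavy-witness` (reshape r3)
of crux `Summit.QuantumFields.QCD.Theses.SpectralDefectExtinction.WindowExtinction`
(item stmt-QuantumFields-8964).  Pure finite-dimensional inequalities over `ℂ`; no lattice vocabulary.

* `stub_fluxTemplateHalf_cycle` (registered): the **magnetic four-cycle bound**.  For vectors
  `a b c d : Fin 3 × Fin 4 → ℂ` and unit phases `u₁ u₂ u₃ u₄` with holonomy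
  `u₁ u₂ ū₃ ū₄ = ω = e^{2πi/3} = -1/2 + i√3/2`,
  `2 Re[u₁⟨a,b⟩ + u₂⟨b,c⟩ + u₃⟨d,c⟩ + u₄⟨a,d⟩] ≤ √3 (‖a‖² + ‖b‖² + ‖c‖² + ‖d‖²)`:
  the Hermitian "adjacency matrix" `N` of the four-cycle with flux `2π/3` has spectrum `{±√3, ±1}`.
  Proof: after gauging the phases onto one edge (`fluxHalf_cycle_phase`), the scalar inequality
  `fluxHalf_cycle_base` is the explicit sum-of-squares identity
  `2√3(√3‖w‖² − ⟨w,Nw⟩) = (3‖w‖² − ‖Nw‖²) + ‖√3 w − Nw‖²` with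
  `3‖w‖² − ‖Nw‖² = |a − (1+ω̄)c|² + |b − (1+ω̄)d|²` (`|1 + ω̄| = 1`), checked by `linarith` on real
  coordinates (`√3` enters only through `s * s = 3`).
* `fluxHalf_edge_bound`: one hopping term `2 Re Σ conj a(a',α) T_{a'b'} b(b',α)` through a colour matrix
  `T` within `η` (entrywise) of a scalar phase `u • 1` is at most `2 Re[u⟨a,b⟩] + 3η(‖a‖² + ‖b‖²)`
  (`fluxHalf_edge_pert`: termwise `2xy ≤ x² + y²`); if the head vector vanishes the bound is free.

These feed the box coercivity estimate of part 2 (`…StubFluxTemplateHalfCoercive.lean`).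
-/

namespace Summit.QuantumFields.QCD.Cruxes.WindowExtinction.FreeVolumeHeavyWitness

open scoped ComplexConjugate BigOperators
open Matrix

/-- **The four-cycle with flux `2π/3`, real coordinates.**  With `s² = 3`, `s > 0` and
`ω = -1/2 + i s/2`: `2 Re[āb + b̄c + c̄d + ω d̄a] ≤ s (|a|² + |b|² + |c|² + |d|²)`, written out in the
real and imaginary parts `a = a₁ + i a₂`, … .  Sum-of-squares certificate (twelve real squares). -/
theorem fluxHalf_cycle_base_real (s : ℝ) (hs : s * s = 3) (hs0 : 0 < s)
    (a1 a2 b1 b2 c1 c2 d1 d2 : ℝ) :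
    2 * (a1 * b1 + a2 * b2 + (b1 * c1 + b2 * c2) + (c1 * d1 + c2 * d2) +
        (-(1 / 2) * (d1 * a1 + d2 * a2) - s / 2 * (d1 * a2 - d2 * a1))) ≤
      s * (a1 ^ 2 + a2 ^ 2 + (b1 ^ 2 + b2 ^ 2) + (c1 ^ 2 + c2 ^ 2) + (d1 ^ 2 + d2 ^ 2)) := by
  have q1 := sq_nonneg (a1 - c1 / 2 - s * c2 / 2)
  have q2 := sq_nonneg (a2 - c2 / 2 + s * c1 / 2)
  have q3 := sq_nonneg (b1 - d1 / 2 - s * d2 / 2)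
  have q4 := sq_nonneg (b2 - d2 / 2 + s * d1 / 2)
  have q5 := sq_nonneg (s * a1 - b1 + d1 / 2 - s * d2 / 2)
  have q6 := sq_nonneg (s * a2 - b2 + d2 / 2 + s * d1 / 2)
  have q7 := sq_nonneg (s * b1 - a1 - c1)
  have q8 := sq_nonneg (s * b2 - a2 - c2)
  have q9 := sq_nonneg (s * c1 - b1 - d1)
  have q10 := sq_nonneg (s * c2 - b2 - d2)
  have q11 := sq_nonneg (s * d1 - c1 + a1 / 2 + s * a2 / 2)
  have q12 := sq_nonneg (s * d2 - c2 + a2 / 2 - s * a1 / 2)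
  have hs2 : s ^ 2 = 3 := by rw [sq]; exact hs
  have e1 : s ^ 2 * a1 ^ 2 = 3 * a1 ^ 2 := by rw [hs2]
  have e2 : s ^ 2 * a2 ^ 2 = 3 * a2 ^ 2 := by rw [hs2]
  have e3 : s ^ 2 * b1 ^ 2 = 3 * b1 ^ 2 := by rw [hs2]
  have e4 : s ^ 2 * b2 ^ 2 = 3 * b2 ^ 2 := by rw [hs2]
  have e5 : s ^ 2 * c1 ^ 2 = 3 * c1 ^ 2 := by rw [hs2]
  have e6 : s ^ 2 * c2 ^ 2 = 3 * c2 ^ 2 := by rw [hs2]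
  have e7 : s ^ 2 * d1 ^ 2 = 3 * d1 ^ 2 := by rw [hs2]
  have e8 : s ^ 2 * d2 ^ 2 = 3 * d2 ^ 2 := by rw [hs2]
  have e9 : s ^ 2 * (a1 * d2) = 3 * (a1 * d2) := by rw [hs2]
  have e10 : s ^ 2 * (a2 * d1) = 3 * (a2 * d1) := by rw [hs2]
  have key : 2 * s * (2 * (a1 * b1 + a2 * b2 + (b1 * c1 + b2 * c2) + (c1 * d1 + c2 * d2) +
        (-(1 / 2) * (d1 * a1 + d2 * a2) - s / 2 * (d1 * a2 - d2 * a1)))) ≤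
      2 * s * (s * (a1 ^ 2 + a2 ^ 2 + (b1 ^ 2 + b2 ^ 2) + (c1 ^ 2 + c2 ^ 2) + (d1 ^ 2 + d2 ^ 2))) := by
    linarith [q1, q2, q3, q4, q5, q6, q7, q8, q9, q10, q11, q12, e1, e2, e3, e4, e5, e6, e7, e8, e9,
      e10]
  exact le_of_mul_le_mul_left key (by positivity)

/-- **The four-cycle with flux `2π/3`, complex form**: `2 Re[āb + b̄c + c̄d + ω d̄a] ≤ √3 Σ|·|²`
for `ω = -1/2 + i√3/2` (`√3` abstracted as `s > 0`, `s² = 3`). -/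
theorem fluxHalf_cycle_base (s : ℝ) (hs : s * s = 3) (hs0 : 0 < s) (a b c d : ℂ) :
    2 * (conj a * b + conj b * c + conj c * d + (⟨-1 / 2, s / 2⟩ : ℂ) * conj d * a).re ≤
      s * (Complex.normSq a + Complex.normSq b + Complex.normSq c + Complex.normSq d) := by
  have h := fluxHalf_cycle_base_real s hs hs0 a.re a.im b.re b.im c.re c.im d.re d.im
  simp only [Complex.add_re, Complex.mul_re, Complex.mul_im, Complex.conj_re, Complex.conj_im,
    Complex.normSq_apply]
  convert h using 2 <;> ring

/-- **The four-cycle with general unit phases of holonomy `ω`** (gauge the phases onto one edge):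
`2 Re[u₁āb + u₂b̄c + u₃d̄c + u₄ād] ≤ √3 Σ|·|²` whenever `|u₁| = |u₂| = |u₃| = 1` and
`u₁ u₂ ū₃ ū₄ = ω`. -/
theorem fluxHalf_cycle_phase (s : ℝ) (hs : s * s = 3) (hs0 : 0 < s) (a b c d u₁ u₂ u₃ u₄ : ℂ)
    (h1 : Complex.normSq u₁ = 1) (h2 : Complex.normSq u₂ = 1) (h3 : Complex.normSq u₃ = 1)
    (hol : u₁ * u₂ * conj u₃ * conj u₄ = (⟨-1 / 2, s / 2⟩ : ℂ)) :
    2 * (u₁ * (conj a * b) + u₂ * (conj b * c) + u₃ * (conj d * c) + u₄ * (conj a * d)).re ≤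
      s * (Complex.normSq a + Complex.normSq b + Complex.normSq c + Complex.normSq d) := by
  have key := fluxHalf_cycle_base s hs hs0 a (u₁ * b) (u₁ * u₂ * c) (u₁ * u₂ * conj u₃ * d)
  have n1 : conj u₁ * u₁ = 1 := by rw [← Complex.normSq_eq_conj_mul_self, h1, Complex.ofReal_one]
  have n2 : conj u₂ * u₂ = 1 := by rw [← Complex.normSq_eq_conj_mul_self, h2, Complex.ofReal_one]
  have n3 : conj u₃ * u₃ = 1 := by rw [← Complex.normSq_eq_conj_mul_self, h3, Complex.ofReal_one]
  rw [← hol] at key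
  simp only [map_mul, Complex.conj_conj] at key
  have E : conj a * (u₁ * b) + conj u₁ * conj b * (u₁ * u₂ * c) +
      conj u₁ * conj u₂ * conj c * (u₁ * u₂ * conj u₃ * d) +
        u₁ * u₂ * conj u₃ * conj u₄ * (conj u₁ * conj u₂ * u₃ * conj d) * a =
      u₁ * (conj a * b) + u₂ * (conj b * c) + conj (u₃ * (conj d * c)) + conj (u₄ * (conj a * d)) := by
    simp only [map_mul, Complex.conj_conj]
    linear_combination (u₂ * conj b * c + conj u₂ * u₂ * conj u₃ * conj c * d +
        conj u₂ * u₂ * conj u₃ * u₃ * conj u₄ * conj d * a) * n1 +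
      (conj u₃ * conj c * d + conj u₃ * u₃ * conj u₄ * conj d * a) * n2 + (conj u₄ * conj d * a) * n3
  rw [E] at key
  simp only [Complex.add_re, Complex.conj_re] at key
  simp only [Complex.normSq_conj, h1, h2, h3, one_mul] at key
  simpa only [Complex.add_re] using key

/-- **Registered helper `stub_fluxTemplateHalf_cycle` (magnetic four-cycle bound, vector form).**
For colour–spinor vectors `a b c d` at the four corners of a plaquette and unit phases of holonomy
`ω = e^{2πi/3}` on its edges, the hopping form around the plaquette is at most `√3` times the total
mass — the spectral radius of the four-cycle with flux `2π/3` (`√3` is abstracted as `s`). -/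
theorem stub_fluxTemplateHalf_cycle :
    ∀ (s : ℝ), s * s = 3 → 0 < s → ∀ (a b c d : Fin 3 × Fin 4 → ℂ) (u₁ u₂ u₃ u₄ : ℂ),
      Complex.normSq u₁ = 1 → Complex.normSq u₂ = 1 → Complex.normSq u₃ = 1 →
      u₁ * u₂ * (starRingEnd ℂ) u₃ * (starRingEnd ℂ) u₄ = (⟨-1 / 2, s / 2⟩ : ℂ) →
      2 * (u₁ * (star a ⬝ᵥ b) + u₂ * (star b ⬝ᵥ c) + u₃ * (star d ⬝ᵥ c) + u₄ * (star a ⬝ᵥ d)).re ≤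
        s * (∑ i, ‖a i‖ ^ 2 + ∑ i, ‖b i‖ ^ 2 + ∑ i, ‖c i‖ ^ 2 + ∑ i, ‖d i‖ ^ 2) := by
  intro s hs hs0 a b c d u₁ u₂ u₃ u₄ h1 h2 h3 hol
  have key : ∀ i, 2 * (u₁ * (conj (a i) * b i) + u₂ * (conj (b i) * c i) +
      u₃ * (conj (d i) * c i) + u₄ * (conj (a i) * d i)).re ≤
        s * (‖a i‖ ^ 2 + ‖b i‖ ^ 2 + ‖c i‖ ^ 2 + ‖d i‖ ^ 2) := by
    intro i
    have := fluxHalf_cycle_phase s hs hs0 (a i) (b i) (c i) (d i) u₁ u₂ u₃ u₄ h1 h2 h3 hol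
    simpa only [Complex.normSq_eq_norm_sq] using this
  have hsum := Finset.sum_le_sum fun i (_ : i ∈ Finset.univ) => key i
  rw [← Finset.mul_sum, ← Finset.mul_sum, ← Complex.re_sum] at hsum
  simp only [Finset.sum_add_distrib, ← Finset.mul_sum] at hsum
  simpa only [dotProduct, Pi.star_apply, Complex.star_def] using hsum

/-- **Perturbation of one hopping term**: for a colour matrix `E` with entries of norm `≤ η` and
vectors `p q` on colour × spin, `2 Re Σ_{a,α} conj p(a,α) Σ_b E_{ab} q(b,α) ≤ (#colours)·η·(‖p‖² + ‖q‖²)`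
(termwise `2|x||y| ≤ |x|² + |y|²`). -/
theorem fluxHalf_edge_pert {ι κ : Type*} [Fintype ι] [Fintype κ] (E : Matrix ι ι ℂ) {η : ℝ}
    (hη : 0 ≤ η) (hE : ∀ a b, ‖E a b‖ ≤ η) (p q : ι × κ → ℂ) :
    2 * (∑ a, ∑ α, conj (p (a, α)) * ∑ b, E a b * q (b, α)).re ≤
      Fintype.card ι * η * (∑ i, ‖p i‖ ^ 2 + ∑ i, ‖q i‖ ^ 2) := by
  have hP : ∑ a : ι, ∑ α : κ, ∑ _b : ι, η * ‖p (a, α)‖ ^ 2 =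
      Fintype.card ι * η * ∑ i, ‖p i‖ ^ 2 := by
    rw [Fintype.sum_prod_type, Finset.mul_sum]
    refine Finset.sum_congr rfl fun a _ => ?_
    rw [Finset.mul_sum]
    refine Finset.sum_congr rfl fun α _ => ?_
    rw [Finset.sum_const, Finset.card_univ, nsmul_eq_mul]
    ring
  have hQ : ∑ _a : ι, ∑ α : κ, ∑ b : ι, η * ‖q (b, α)‖ ^ 2 =
      Fintype.card ι * η * ∑ i, ‖q i‖ ^ 2 := by
    have h1 : ∑ α : κ, ∑ b : ι, η * ‖q (b, α)‖ ^ 2 = η * ∑ i, ‖q i‖ ^ 2 := by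
      rw [Fintype.sum_prod_type, Finset.sum_comm, Finset.mul_sum]
      refine Finset.sum_congr rfl fun α _ => ?_
      rw [Finset.mul_sum]
    rw [h1, Finset.sum_const, Finset.card_univ, nsmul_eq_mul]
    ring
  calc 2 * (∑ a, ∑ α, conj (p (a, α)) * ∑ b, E a b * q (b, α)).re
      = ∑ a, ∑ α, ∑ b, 2 * (conj (p (a, α)) * (E a b * q (b, α))).re := by
        simp only [Finset.mul_sum, Complex.re_sum]
    _ ≤ ∑ a, ∑ α, ∑ b, (η * ‖p (a, α)‖ ^ 2 + η * ‖q (b, α)‖ ^ 2) := by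
        gcongr with a _ α _ b _
        have h1 : (conj (p (a, α)) * (E a b * q (b, α))).re ≤ ‖p (a, α)‖ * (η * ‖q (b, α)‖) := by
          refine (Complex.re_le_norm _).trans ?_
          rw [norm_mul, norm_mul, Complex.norm_conj]
          gcongr
          exact hE a b
        nlinarith [sq_nonneg (‖p (a, α)‖ - ‖q (b, α)‖), norm_nonneg (p (a, α)),
          norm_nonneg (q (b, α)), hη, mul_nonneg hη (sq_nonneg (‖p (a, α)‖ - ‖q (b, α)‖))]
    _ = Fintype.card ι * η * (∑ i, ‖p i‖ ^ 2 + ∑ i, ‖q i‖ ^ 2) := by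
        simp only [Finset.sum_add_distrib]
        rw [hP, hQ]
        ring

/-- **One edge of a plaquette.**  If the colour link `T` is within `η` (entrywise) of the scalar phase
`u • 1` — or if the head vector `p` vanishes — then the hopping term through `T` is at most the scalar
hopping term `2 Re[u ⟨p, q⟩]` plus `3η (‖p‖² + ‖q‖²)`. -/
theorem fluxHalf_edge_bound {κ : Type*} [Fintype κ] (T : Matrix (Fin 3) (Fin 3) ℂ) (u : ℂ) {η : ℝ}
    (hη : 0 ≤ η) (p q : Fin 3 × κ → ℂ)
    (h : p = 0 ∨ ∀ a b, ‖T a b - u * (1 : Matrix (Fin 3) (Fin 3) ℂ) a b‖ ≤ η) :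
    2 * (∑ a, ∑ α, conj (p (a, α)) * ∑ b, T a b * q (b, α)).re ≤
      2 * (u * (star p ⬝ᵥ q)).re + 3 * η * (∑ i, ‖p i‖ ^ 2 + ∑ i, ‖q i‖ ^ 2) := by
  rcases h with hp | hT
  · subst hp
    simp only [Pi.zero_apply, map_zero, zero_mul, Finset.sum_const_zero, Complex.zero_re,
      mul_zero, star_zero, zero_dotProduct, zero_add, norm_zero]
    have : 0 ≤ ∑ i, ‖q i‖ ^ 2 := Finset.sum_nonneg fun i _ => by positivity
    positivity
  · set E : Matrix (Fin 3) (Fin 3) ℂ := fun a b => T a b - u * (1 : Matrix (Fin 3) (Fin 3) ℂ) a b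
      with hEdef
    have hsplit : ∀ a α, ∑ b, T a b * q (b, α) = u * q (a, α) + ∑ b, E a b * q (b, α) := by
      intro a α
      have h1 : ∑ b, (1 : Matrix (Fin 3) (Fin 3) ℂ) a b * q (b, α) = q (a, α) := by
        simp [Matrix.one_apply]
      simp only [hEdef, sub_mul, Finset.sum_sub_distrib, mul_assoc, ← Finset.mul_sum, h1]
      ring
    have hpert := fluxHalf_edge_pert E hη (fun a b => hT a b) p q
    have hip : star p ⬝ᵥ q = ∑ a, ∑ α, conj (p (a, α)) * q (a, α) := by
      rw [dotProduct, Fintype.sum_prod_type]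
      rfl
    have hL : (∑ a, ∑ α, conj (p (a, α)) * ∑ b, T a b * q (b, α)) =
        u * (star p ⬝ᵥ q) + ∑ a, ∑ α, conj (p (a, α)) * ∑ b, E a b * q (b, α) := by
      rw [hip, Finset.mul_sum, ← Finset.sum_add_distrib]
      refine Finset.sum_congr rfl fun a _ => ?_
      rw [Finset.mul_sum, ← Finset.sum_add_distrib]
      refine Finset.sum_congr rfl fun α _ => ?_
      rw [hsplit]
      ring
    rw [hL, Complex.add_re, mul_add]
    simp only [Fintype.card_fin, Nat.cast_ofNat] at hpert
    linarith

end Summit.QuantumFields.QCD.Cruxes.WindowExtinction.FreeVolumeHeavyWitness
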